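import Mathlib
import HarnessLib
import Summits.NavierStokesRegularity.NavierStokesRegularity.Theorems.TaylorModelRungThreeCertificateStageNumericsDefect

/-!
# Crux K1b-DR (stmt-NavierStokesRegularity-23954), line `taylor-model` — the truncated field over COORDINATE BOXES
# (first brick of the componentwise / vector majorant, memo `certificates/S1-VECTOR-23954.md` §2–§4 (B))

The STAGENUMERICS bilinear clause bounds `Qb` in ONE weighted norm (`sn_qB_le`, p608456: `|qB u v|_{ik} ≤
Nu·Nv·φ(bilinK)` from `|u| ≤ Nu·ω`, `|v| ≤ Nv·ω`). The vector (interval-Taylor) step of the memo needs the same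
bound with ARBITRARY per-coordinate bounds — the interval evaluation `Q(B, B′)` of the field over two coordinate
boxes: if `|u_c| ≤ φ(U c)` and `|v_c| ≤ φ(V c)` on the window coordinates, then at every window target `(i, k)`
`|qB d u v i k| ≤ φ (qBndK U V i k)` with `qBndK U V i k = Σ_{(a,b,μ): both factors on the window}
|coef_{ik}(a,b,μ)|·U(idx a k₁)·V(idx b k₂)` (`sn_qB_le_of_coordBound`), hence
`|d.Qb u v i k| ≤ φ ((qBndK U V i k + qBndK V U i k)/2)` (`sn_Qb_le_of_coordBound`) and the diagonal case
`|d.qT y i k| ≤ φ (qBndK Y Y i k)` (`sn_qT_le_of_coordBound`). No new table data: the tensor is `|coefAt|` itself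
(under `CoefOK φ T`); the checker-side `qBndK` is `bilinK`/`defectK` with coordinate bounds in place of `ω`/`M`.
This is the base case `k = 0 → 1` of the interval jets of the memo's §1/§3; the jet recursion over boxes and the
rough-enclosure / Lagrange-remainder lemmas are the next files (owners per the memo).

MODEL-lattice bookkeeping only (rung TL-M3); nothing here concerns the Navier–Stokes equations.
-/

-- the sub-problem namespace repeats the summit name by design (D-0017)
set_option linter.dupNamespace false

namespace Summit.NavierStokesRegularity.NavierStokesRegularity.Theorems.TaylorModelCert

open scoped BigOperators
open Literature.Analysis.FluidPDE.TaoCascade Literature.Analysis.FluidPDE.TaoCascade.TaylorChain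
open Summit.NavierStokesRegularity.NavierStokesRegularity.Theorems.TaylorModelReadout (trunc trunc_apply qB Qb_eq qT_eq_qB)

namespace CertTables

section Defs

variable {K : Type} [Field K] [LinearOrder K]

/-- **Bilinear coordinate bound of the truncated field over two coordinate boxes** (interval evaluation
`|Q|(U, V)` at the window target `(i, k)`): the sum over the monomials with BOTH factors on the window of
`|coef|·U(factor 1)·V(factor 2)`, the bounds `U V : ℕ → K` indexed by window coordinates. [folklore] -/
def qBndK (T : CertTables K) (U V : ℕ → K) (i : Fin 4) (k : ℤ) : K :=
  sumN 4 fun a => sumN 4 fun b => sumN 4 fun μi =>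
    if (-T.Kb ≤ fShell₁ μi k ∧ fShell₁ μi k ≤ T.Ka) ∧ (-T.Kb ≤ fShell₂ μi k ∧ fShell₂ μi k ≤ T.Ka) then
      |T.coefAt ⟨a % 4, Nat.mod_lt _ (by omega)⟩ ⟨b % 4, Nat.mod_lt _ (by omega)⟩ i μi k| *
        U (T.idx ⟨a % 4, Nat.mod_lt _ (by omega)⟩ (fShell₁ μi k)) *
        V (T.idx ⟨b % 4, Nat.mod_lt _ (by omega)⟩ (fShell₂ μi k))
    else 0

end Defs

section Sound

variable {K : Type} [Field K] [LinearOrder K] {φ : K →+* ℝ} (hφ : Monotone φ) (T : CertTables K)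
include hφ

/-- **`qB` over coordinate boxes**: `|u_c| ≤ φ(U c)`, `|v_c| ≤ φ(V c)` on the window coordinates ⇒
`|qB d u v i k| ≤ φ (qBndK U V i k)` at every window target (under `CoefOK φ T`). [folklore] -/
theorem sn_qB_le_of_coordBound (hco : T.CoefOK φ) {u v : Fin 4 → ℤ → ℝ} {U V : ℕ → K}
    (hu : ∀ c < T.n, |T.wv u c| ≤ φ (U c)) (hv : ∀ c < T.n, |T.wv v c| ≤ φ (V c))
    (i : Fin 4) {k : ℤ} (hk : -T.Kb ≤ k ∧ k ≤ T.Ka) :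
    |qB (T.toCertData φ) u v i k| ≤ φ (T.qBndK U V i k) := by
  set d := T.toCertData φ with hd
  have hKb : d.Kb = T.Kb := rfl
  have hKa : d.Ka = T.Ka := rfl
  -- coordinate bounds read at window pairs `(a', k')`
  have hu' : ∀ (a' : Fin 4) {k' : ℤ}, (-T.Kb ≤ k' ∧ k' ≤ T.Ka) → |u a' k'| ≤ φ (U (T.idx a' k')) := by
    intro a' k' hk'
    have h := hu (T.idx a' k') (T.idx_lt_n a' hk')
    rwa [T.wv_idx u a' hk'] at h
  have hv' : ∀ (a' : Fin 4) {k' : ℤ}, (-T.Kb ≤ k' ∧ k' ≤ T.Ka) → |v a' k'| ≤ φ (V (T.idx a' k')) := by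
    intro a' k' hk'
    have h := hv (T.idx a' k') (T.idx_lt_n a' hk')
    rwa [T.wv_idx v a' hk'] at h
  unfold qB
  rw [hKb, hKa, if_pos hk]
  have hK : φ (T.qBndK U V i k) = ∑ a ∈ Finset.range 4, ∑ b ∈ Finset.range 4, ∑ μi ∈ Finset.range 4,
      φ (if (-T.Kb ≤ fShell₁ μi k ∧ fShell₁ μi k ≤ T.Ka) ∧ (-T.Kb ≤ fShell₂ μi k ∧ fShell₂ μi k ≤ T.Ka) then
        |T.coefAt ⟨a % 4, Nat.mod_lt _ (by omega)⟩ ⟨b % 4, Nat.mod_lt _ (by omega)⟩ i μi k| *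
          U (T.idx ⟨a % 4, Nat.mod_lt _ (by omega)⟩ (fShell₁ μi k)) *
          V (T.idx ⟨b % 4, Nat.mod_lt _ (by omega)⟩ (fShell₂ μi k)) else 0) := by
    simp only [qBndK, phi_sumN]
  rw [hK]
  refine sn_abs_sum3_le _ _ fun a ha b hb μi hμ => ?_
  set a' : Fin 4 := ⟨a % 4, Nat.mod_lt _ (by omega)⟩
  set b' : Fin 4 := ⟨b % 4, Nat.mod_lt _ (by omega)⟩
  have hs1 : k - (shifts.getD μi (0, 0, 0)).2.2 + (shifts.getD μi (0, 0, 0)).1 = fShell₁ μi k := rfl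
  have hs2 : k - (shifts.getD μi (0, 0, 0)).2.2 + (shifts.getD μi (0, 0, 0)).2.1 = fShell₂ μi k := rfl
  simp only [trunc_apply]
  rw [hs1, hs2, hKb, hKa]
  have hcoef : d.α a' b' i (shifts.getD μi (0, 0, 0)) * (1 + 1 : ℝ) ^ ((5 : ℝ) * (k - (shifts.getD μi (0, 0, 0)).2.2) / 2) =
      φ (T.coefAt a' b' i μi k) := by
    rw [hco a' b' i μi k hμ hk.1 hk.2, hd, toCertData_α, shifts_getD μi hμ, if_pos hμ, one_add_one_eq_two]
  by_cases hboth : (-T.Kb ≤ fShell₁ μi k ∧ fShell₁ μi k ≤ T.Ka) ∧ (-T.Kb ≤ fShell₂ μi k ∧ fShell₂ μi k ≤ T.Ka)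
  · rw [if_pos hboth, if_pos hboth.1, if_pos hboth.2, hcoef, abs_mul, abs_mul, map_mul, map_mul, phi_abs hφ,
      mul_assoc |φ _|]
    have h1 := hu' a' hboth.1
    have h2 := hv' b' hboth.2
    have hU0 : 0 ≤ φ (U (T.idx a' (fShell₁ μi k))) := (abs_nonneg _).trans h1
    exact mul_le_mul_of_nonneg_left (mul_le_mul h1 h2 (abs_nonneg _) hU0) (abs_nonneg _)
  · rw [if_neg hboth, map_zero]
    have hzero : (if -T.Kb ≤ fShell₁ μi k ∧ fShell₁ μi k ≤ T.Ka then u a' (fShell₁ μi k) else 0) *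
        (if -T.Kb ≤ fShell₂ μi k ∧ fShell₂ μi k ≤ T.Ka then v b' (fShell₂ μi k) else 0) = 0 := by
      rcases not_and_or.1 hboth with h1 | h2
      · rw [if_neg h1, zero_mul]
      · rw [if_neg h2, mul_zero]
    rw [hzero, mul_zero, abs_zero]

/-- **`Qb` over coordinate boxes** (polarisation): `|d.Qb u v i k| ≤ φ ((qBndK U V i k + qBndK V U i k) / 2)`.
[folklore] -/
theorem sn_Qb_le_of_coordBound (hco : T.CoefOK φ) {u v : Fin 4 → ℤ → ℝ} {U V : ℕ → K}
    (hu : ∀ c < T.n, |T.wv u c| ≤ φ (U c)) (hv : ∀ c < T.n, |T.wv v c| ≤ φ (V c))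
    (i : Fin 4) {k : ℤ} (hk : -T.Kb ≤ k ∧ k ≤ T.Ka) :
    |(T.toCertData φ).Qb u v i k| ≤ φ ((T.qBndK U V i k + T.qBndK V U i k) / 2) := by
  have h1 := T.sn_qB_le_of_coordBound hφ hco hu hv i hk
  have h2 := T.sn_qB_le_of_coordBound hφ hco hv hu i hk
  rw [Qb_eq, map_div₀, map_add, map_ofNat, abs_div, abs_two]
  gcongr
  exact (abs_add_le _ _).trans (add_le_add h1 h2)

/-- **The truncated field over a coordinate box** (diagonal case): `|d.qT y i k| ≤ φ (qBndK Y Y i k)`. [folklore] -/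
theorem sn_qT_le_of_coordBound (hco : T.CoefOK φ) {y : Fin 4 → ℤ → ℝ} {Y : ℕ → K}
    (hy : ∀ c < T.n, |T.wv y c| ≤ φ (Y c)) (i : Fin 4) {k : ℤ} (hk : -T.Kb ≤ k ∧ k ≤ T.Ka) :
    |(T.toCertData φ).qT y i k| ≤ φ (T.qBndK Y Y i k) := by
  rw [qT_eq_qB]
  exact T.sn_qB_le_of_coordBound hφ hco hy hy i hk

end Sound

end CertTables

end Summit.NavierStokesRegularity.NavierStokesRegularity.Theorems.TaylorModelCert
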